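import Summits.QuantumAdvantage.QuantumAdvantage.Theses.MobiusLadder
import Literature.Computability.MetaComplexity.RazborovSmolenskyApprox
import Literature.Computability.Complexity.CircuitLowerBounds

/-!
# Support item `MobiusLadder.LiouvilleNotAC0Xor` (stmt-QuantumAdvantage-1397)

`LiouvilleNotAC0Xor := DigitPolyUniformity → L_λ ∉ AC⁰[⊕]` — the Razborov–Smolensky glue of the
`AC⁰[⊕]` rung (R1) of route `MobiusLadder`.

## What is proved
`LiouvilleNotAC0Xor_proof : LiouvilleNotAC0Xor` (the type is literally the route decl),
unconditionally and with no named-fact hypothesis: if `λ` is orthogonal to all `𝔽₂`-polynomial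
phases of degree `≤ (log₂ n)^A` in the digits (`DigitPolyUniformity`, crux stmt-1392), then the
Liouville language `L_λ = {bin(N) : λ(N) = -1}` (canonical LSB-first codes, Mathlib
`Computability.encodingNatBool`) is decided by no constant-depth polynomial-size circuit family
over `{¬, ∧, ∨, MOD₂}` (`Literature.Computability.Complexity.AC0Mod 2`).

## Proof (Razborov 1987 / Smolensky 1987, as the planner's docstring prescribes)
* The approximation step is IMPORTED, not redone: the tree's Razborov–Smolensky lemma
  `Literature.Computability.MetaComplexity.Smolensky.razborov_smolensky` (files
  `MetaComplexity/RazborovSmolenskyPoly.lean`, `RazborovSmolenskyApprox.lean`) gives, for a circuit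
  over `accBasis 2` and `ℓ ≥ 1`, a function `P ∈ lowDeg 𝔽₂ n (ℓ^{acDepth})` and an error set `E`
  with `|E| · 2^ℓ ≤ size · 2ⁿ`. `exists_mvPolynomial_of_mem_lowDeg` turns membership in the span of
  the multilinear monomials into an honest `MvPolynomial (Fin n) (ZMod 2)` of `totalDegree ≤ D`
  (the vocabulary of `DigitPolyUniformity`).
* Bookkeeping: size `≤ p(n) ≤ n^k` (`k = deg p + 1`, `n ≥ p(1)`; the tree's
  `Complexity.natPoly_eval_le_eval_one_mul_pow`), `ℓ = k (log₂ n + 1) + 3`, so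
  `2^ℓ ≥ 8 n^k`, `8|E| ≤ 2ⁿ`, and `ℓ^d ≤ (2(k+3))^d (log₂ n)^d ≤ (log₂ n)^{d+1}` once
  `log₂ n ≥ (2(k+3))^d`; the uniformity hypothesis is used with `A = d + 1`, `ε = 1/8`.
* The codeword glue needs NO number theory beyond `λ(N) ∈ {±1}` for `N ≠ 0`: comparing the
  uniformity sums of `P` and of `P + x_{n-1}` (`abs_sum_le_of_twist`, `sign_add_bit`) isolates the
  top half `T = {N < 2ⁿ : bit n-1 set} ⊇ [2^{n-1}, 2ⁿ)`, where the `n` low bits of `N` are exactly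
  `encodeNat N` (`encodeNat_eq_ofFn`, via `Cryptography.encodeNat_eq_bits`), so that
  `Cₙ(bits N) = [λ(N) = -1]` (`CircuitFamily.Decides.eval_eq`, `ofFn_mem_toLanguage_iff`) and
  `λ(N) χ_P(N) = 1` off `E`; hence `2ⁿ/2 - 2|E| ≤ Σ_T λ χ_P ≤ 2ⁿ/8` (`card_sub_le_sum`,
  `testBit_injOn`), impossible.

## What this does NOT say
Nothing about the truth of `DigitPolyUniformity` (open; crux of the route). The lemma is the
class glue only; the quantitative form (correlation `2^{-Ω(·)}`) is not needed and not proved.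
-/

set_option linter.dupNamespace false -- D-0017: single-problem summit ⇒ `QuantumAdvantage.QuantumAdvantage` by design

namespace Summit.QuantumAdvantage.QuantumAdvantage.Theorems.MobiusLadder

open Summit.QuantumAdvantage.QuantumAdvantage.Theses.MobiusLadder
open Literature.Computability.Complexity Literature.Computability.MetaComplexity
open Finset Filter

/-! ### From the degree filtration on the cube to honest polynomials -/

/-- A function on the cube in Smolensky's degree filtration `lowDeg F n D` (the span of the
multilinear monomials `x_S`, `|S| ≤ D`) is the restriction to `{0,1}ⁿ` of a polynomial of total
degree at most `D`. [folklore] -/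
theorem exists_mvPolynomial_of_mem_lowDeg {F : Type*} [Field F] {n D : ℕ}
    {P : Smolensky.CubeFn F n} (hP : P ∈ Smolensky.lowDeg F n D) :
    ∃ Q : MvPolynomial (Fin n) F, Q.totalDegree ≤ D ∧
      ∀ x : Fin n → Bool, MvPolynomial.eval (fun i => if x i then (1 : F) else 0) Q = P x := by
  induction hP using Submodule.span_induction with
  | mem f hf =>
    obtain ⟨⟨S, hS⟩, rfl⟩ := hf
    refine ⟨∏ i ∈ S, MvPolynomial.X i, ?_, fun x => ?_⟩
    · calc (∏ i ∈ S, (MvPolynomial.X i : MvPolynomial (Fin n) F)).totalDegree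
          ≤ ∑ i ∈ S, (MvPolynomial.X i : MvPolynomial (Fin n) F).totalDegree :=
            MvPolynomial.totalDegree_finsetProd _ _
        _ ≤ ∑ _i ∈ S, 1 := Finset.sum_le_sum fun i _ => by rw [MvPolynomial.totalDegree_X]
        _ = S.card := by simp
        _ ≤ D := hS
    · simp only [map_prod, MvPolynomial.eval_X, Smolensky.mono]
  | zero => exact ⟨0, by simp, fun x => by simp⟩
  | add f g _ _ ihf ihg =>
    obtain ⟨Q₁, h₁, e₁⟩ := ihf
    obtain ⟨Q₂, h₂, e₂⟩ := ihg
    refine ⟨Q₁ + Q₂, (MvPolynomial.totalDegree_add _ _).trans (max_le h₁ h₂), fun x => ?_⟩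
    simp [e₁, e₂]
  | smul a f _ ih =>
    obtain ⟨Q, h, e⟩ := ih
    refine ⟨a • Q, (MvPolynomial.totalDegree_smul_le _ _).trans h, fun x => ?_⟩
    rw [MvPolynomial.smul_eval, e]
    rfl

/-! ### Binary digits and the canonical encodings -/

/-- A number `N < 2ⁿ` whose bit `n - 1` is set is encoded (`encodeNat`, LSB first) by exactly its
`n` low bits. [folklore] -/
theorem encodeNat_eq_ofFn {n N : ℕ} (hN : N < 2 ^ n) (htop : Nat.testBit N (n - 1) = true) :
    Computability.encodeNat N = List.ofFn (fun i : Fin n => Nat.testBit N i) := by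
  have hge : 2 ^ (n - 1) ≤ N := Nat.ge_two_pow_of_testBit htop
  have hsize : N.size = n := by
    apply le_antisymm (Nat.size_le.2 hN)
    have := Nat.lt_size.2 hge
    omega
  rw [Literature.Computability.Cryptography.encodeNat_eq_bits]
  apply List.ext_getElem
  · rw [List.length_ofFn, Nat.size_eq_bits_len, hsize]
  · intro i h1 h2
    rw [List.getElem_ofFn]
    have := Nat.testBit_eq_inth N i
    rw [List.getI_eq_getElem _ h1] at this
    exact this.symm

/-- Conversely, if `encodeNat M` is the list of the `n` low bits of some `N < 2ⁿ` then `M = N`.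
[folklore] -/
theorem eq_of_encodeNat_eq_ofFn {n N M : ℕ} (hN : N < 2 ^ n)
    (h : Computability.encodeNat M = List.ofFn (fun i : Fin n => Nat.testBit N i)) : M = N := by
  apply Nat.eq_of_testBit_eq
  intro i
  rw [Nat.testBit_eq_inth M i, ← Literature.Computability.Cryptography.encodeNat_eq_bits, h]
  by_cases hi : i < n
  · rw [List.getI_eq_getElem _ (by simpa using hi), List.getElem_ofFn]
  · rw [List.getI_eq_default _ (by simpa using not_lt.1 hi)]
    exact (Nat.testBit_lt_two_pow (hN.trans_le (Nat.pow_le_pow_right two_pos (not_lt.1 hi)))).symm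

/-- Membership of the bit string of `N < 2ⁿ` with top bit set in the language of a set of
naturals is membership of `N` in the set. [folklore] -/
theorem ofFn_mem_toLanguage_iff {n N : ℕ} (S : Set ℕ) (hN : N < 2 ^ n)
    (htop : Nat.testBit N (n - 1) = true) :
    List.ofFn (fun i : Fin n => Nat.testBit N i) ∈ Computability.encodingNatBool.toLanguage S ↔
      N ∈ S := by
  constructor
  · rintro ⟨M, hM, hMe⟩
    rwa [← eq_of_encodeNat_eq_ofFn hN hMe]
  · intro h
    exact ⟨N, h, encodeNat_eq_ofFn hN htop⟩

/-- The map `N ↦ (low n bits of N)` is injective on `[0, 2ⁿ)`. [folklore] -/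
theorem testBit_injOn (n : ℕ) :
    Set.InjOn (fun N : ℕ => fun i : Fin n => Nat.testBit N i) (Finset.range (2 ^ n) : Set ℕ) := by
  intro N hN M hM h
  simp only [Finset.coe_range, Set.mem_Iio] at hN hM
  apply Nat.eq_of_testBit_eq
  intro i
  by_cases hi : i < n
  · exact congrFun h ⟨i, hi⟩
  · rw [Nat.testBit_lt_two_pow (hN.trans_le (Nat.pow_le_pow_right two_pos (not_lt.1 hi))),
      Nat.testBit_lt_two_pow (hM.trans_le (Nat.pow_le_pow_right two_pos (not_lt.1 hi)))]

/-! ### Small arithmetic facts -/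

/-- Sign characters on `𝔽₂` are multiplicative: `(-1)^{u + b} = (-1)^u (-1)^b`. [folklore] -/
theorem sign_add_bit (u : ZMod 2) (b : Bool) :
    (if u + (if b then 1 else 0) = 1 then (-1 : ℝ) else 1) =
      (if u = 1 then (-1 : ℝ) else 1) * (if b then -1 else 1) := by
  have hu : u = 0 ∨ u = 1 := by
    fin_cases u
    · exact Or.inl rfl
    · exact Or.inr rfl
  have h11 : (1 : ZMod 2) + 1 ≠ 1 := by decide
  have h01 : (0 : ZMod 2) ≠ 1 := by decide
  rcases hu with rfl | rfl <;> cases b <;> simp [h11, h01]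

/-! ### Two abstract summation facts -/

/-- Isolating a sub-sum with a sign twist: if `|Σ_R a| ≤ B` and `|Σ_R a·t| ≤ B` where `t = -1`
on `T ⊆ R` and `t = 1` on `R ∖ T`, then `|Σ_T a| ≤ B`. [folklore] -/
theorem abs_sum_le_of_twist {R T : Finset ℕ} (hTR : T ⊆ R) {a t : ℕ → ℝ} {B : ℝ}
    (hon : ∀ N ∈ T, t N = -1) (hoff : ∀ N ∈ R, N ∉ T → t N = 1)
    (h1 : |∑ N ∈ R, a N| ≤ B) (h2 : |∑ N ∈ R, a N * t N| ≤ B) :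
    |∑ N ∈ T, a N| ≤ B := by
  have key : ∑ N ∈ R, a N - ∑ N ∈ R, a N * t N = 2 * ∑ N ∈ T, a N := by
    rw [← Finset.sum_sub_distrib, Finset.mul_sum,
      ← Finset.sum_subset hTR (f := fun N => a N - a N * t N) ?_]
    · refine Finset.sum_congr rfl fun N hN => ?_
      rw [hon N hN]
      ring
    · intro N hNR hNT
      rw [hoff N hNR hNT]
      ring
  have h3 : |2 * ∑ N ∈ T, a N| ≤ B + B := by
    rw [← key]
    exact (abs_sub _ _).trans (add_le_add h1 h2)
  rw [abs_mul, abs_two] at h3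
  linarith [abs_nonneg (∑ N ∈ T, a N)]

/-- A sum of terms `≥ -1` which equal `1` off a bad set is at least `#T - 2 · #bad`. [folklore] -/
theorem card_sub_le_sum {T : Finset ℕ} {a : ℕ → ℝ} (bad : ℕ → Prop) [DecidablePred bad]
    (hgood : ∀ N ∈ T, ¬ bad N → a N = 1) (hbad : ∀ N ∈ T, -1 ≤ a N) :
    (T.card : ℝ) - 2 * ((T.filter bad).card : ℝ) ≤ ∑ N ∈ T, a N := by
  have hsum : ∑ N ∈ T, ((1 : ℝ) - 2 * (if bad N then 1 else 0)) =
      (T.card : ℝ) - 2 * ((T.filter bad).card : ℝ) := by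
    rw [Finset.sum_sub_distrib, ← Finset.mul_sum, Finset.sum_boole, Finset.sum_const]
    simp
  rw [← hsum]
  refine Finset.sum_le_sum fun N hN => ?_
  by_cases hb : bad N
  · rw [if_pos hb]
    have := hbad N hN
    linarith
  · rw [if_neg hb, hgood N hN hb]
    norm_num

/-! ### The item -/

/-- **Item stmt-QuantumAdvantage-1397, settled** (`LiouvilleNotAC0Xor`): digital low-degree
uniformity of `λ` (`DigitPolyUniformity`) implies that the Liouville language
`L_λ = {bin(N) : λ(N) = -1}` is not in `AC⁰[⊕] = AC0Mod 2`.

Proof (Razborov 1987 / Smolensky 1987 glue). Let `(Cₙ)` over `accBasis 2` of depth `≤ d` and size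
`≤ p(n) ≤ n^k` decide `L_λ`. With `ℓ = k (log₂ n + 1) + 3` the tree's Razborov–Smolensky lemma
(`Smolensky.razborov_smolensky`) gives a polynomial `P` over `𝔽₂` of degree `≤ ℓ^d ≤ (log₂ n)^{d+1}`
(for `log₂ n ≥ (2(k+3))^d`) agreeing with `Cₙ` off a set `E` with `8 |E| ≤ 2ⁿ`. Comparing the
uniformity sums (with `A = d + 1`, `ε = 1/8`) of `P` and of `P + x_{n-1}` isolates the top half
`T = [2^{n-1}, 2ⁿ)`: `|Σ_T λ χ_P| ≤ 2ⁿ/8`. But on `T` the `n` low bits of `N` ARE the code word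
`encodeNat N`, so `Cₙ(bits N) = [λ(N) = -1]` and `λ(N) χ_P(N) = λ(N)² = 1` off `E`, whence
`Σ_T λ χ_P ≥ 2ⁿ/2 - 2|E| ≥ 2ⁿ/4`, a contradiction. No property of `λ` beyond `λ(N) = ±1` for
`N ≠ 0` is used. Unconditional; the type is literally the route decl.
[cite: Smolensky1987, Lemmas 1–2] -/
theorem LiouvilleNotAC0Xor_proof : LiouvilleNotAC0Xor := by
  intro hU hL
  obtain ⟨d, p, C, hC, hdec⟩ := hL
  set k : ℕ := p.natDegree + 1 with hk
  set c : ℕ := 2 * (k + 3) with hc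
  have hε : (0 : ℝ) < 1 / 8 := by norm_num
  have hpoly : ∀ᶠ m : ℕ in atTop, p.eval m ≤ m ^ k := by
    refine (eventually_ge_atTop (max 1 (p.eval 1))).mono fun m hm => ?_
    calc p.eval m ≤ p.eval 1 * m ^ p.natDegree :=
          natPoly_eval_le_eval_one_mul_pow p (le_of_max_le_left hm)
      _ ≤ m * m ^ p.natDegree := Nat.mul_le_mul_right _ (le_of_max_le_right hm)
      _ = m ^ k := by rw [hk, pow_succ']
  obtain ⟨n, hn1, hn2, hn3⟩ := ((hU (d + 1) (1 / 8) hε).and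
    (hpoly.and (eventually_ge_atTop (2 ^ (c ^ d))))).exists
  have hcd : 1 ≤ c ^ d := Nat.one_le_pow _ _ (by omega)
  have hlog : c ^ d ≤ Nat.log 2 n := Nat.le_log_of_pow_le one_lt_two hn3
  have hlog1 : 1 ≤ Nat.log 2 n := hcd.trans hlog
  have hn0 : n ≠ 0 := by
    rintro rfl
    simp at hlog1
  have hn2' : 2 ≤ n := by simpa using Nat.pow_le_of_le_log hn0 hlog1
  obtain ⟨hover, hdepth, hsize⟩ := hC n
  -- Razborov–Smolensky at length `n`
  set ℓ : ℕ := k * (Nat.log 2 n + 1) + 3 with hℓ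
  have hℓ1 : 1 ≤ ℓ := by omega
  obtain ⟨Pf, E, hPf, hE, hagree⟩ := Smolensky.razborov_smolensky (C n) hover hℓ1
  have hℓc : ℓ ≤ c * Nat.log 2 n := by
    have h2 : k + 3 ≤ (k + 3) * Nat.log 2 n := Nat.le_mul_of_pos_right _ hlog1
    rw [hℓ, hc]
    nlinarith
  have hdeg : ((2 - 1) * ℓ) ^ (C n).acDepth ≤ Nat.log 2 n ^ (d + 1) := by
    rw [show (2 - 1) * ℓ = ℓ by omega]
    calc ℓ ^ (C n).acDepth ≤ ℓ ^ d := Nat.pow_le_pow_right hℓ1 hdepth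
      _ ≤ (c * Nat.log 2 n) ^ d := Nat.pow_le_pow_left hℓc d
      _ = c ^ d * Nat.log 2 n ^ d := mul_pow _ _ _
      _ ≤ Nat.log 2 n * Nat.log 2 n ^ d := Nat.mul_le_mul_right _ hlog
      _ = Nat.log 2 n ^ (d + 1) := (pow_succ' _ _).symm
  obtain ⟨P, hPdeg, hPeval⟩ :=
    exists_mvPolynomial_of_mem_lowDeg (Smolensky.lowDeg_mono hdeg hPf)
  -- the error set is small: `8 |E| ≤ 2ⁿ`
  have hE8 : 8 * E.card ≤ 2 ^ n := by
    have h1 : n ^ k < 2 ^ (k * (Nat.log 2 n + 1)) := by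
      rw [pow_mul']
      exact Nat.pow_lt_pow_left (Nat.lt_pow_succ_log_self one_lt_two n) (by omega)
    have h2 : 2 ^ ℓ = 2 ^ (k * (Nat.log 2 n + 1)) * 8 := by
      rw [hℓ, pow_add]
      norm_num
    have h3 : E.card * 2 ^ ℓ ≤ n ^ k * 2 ^ n :=
      hE.trans (Nat.mul_le_mul_right _ (hsize.trans hn2))
    have h4 : E.card * (n ^ k * 8) ≤ E.card * 2 ^ ℓ := by
      rw [h2]
      exact Nat.mul_le_mul_left _ (Nat.mul_le_mul_right _ h1.le)
    have hnk : 0 < n ^ k := Nat.pow_pos (by omega)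
    have h5 : n ^ k * (8 * E.card) ≤ n ^ k * 2 ^ n :=
      calc n ^ k * (8 * E.card) = E.card * (n ^ k * 8) := by ring
        _ ≤ E.card * 2 ^ ℓ := h4
        _ ≤ n ^ k * 2 ^ n := h3
    exact Nat.le_of_mul_le_mul_left h5 hnk
  -- the two test polynomials `P` and `Q = P + x_{n-1}`
  have hn1n : n - 1 < n := by omega
  obtain ⟨Q, hQdef⟩ : ∃ Q : MvPolynomial (Fin n) (ZMod 2), Q = P + MvPolynomial.X ⟨n - 1, hn1n⟩ :=
    ⟨_, rfl⟩
  have hDg1 : 1 ≤ Nat.log 2 n ^ (d + 1) := Nat.one_le_pow _ _ hlog1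
  have hQdeg : Q.totalDegree ≤ Nat.log 2 n ^ (d + 1) := by
    rw [hQdef]
    refine (MvPolynomial.totalDegree_add _ _).trans (max_le hPdeg ?_)
    rw [MvPolynomial.totalDegree_X]
    exact hDg1
  have hSP := hn1 P hPdeg
  have hSQ := hn1 Q hQdeg
  -- the top half `T`
  set R : Finset ℕ := Finset.range (2 ^ n) with hR
  set T : Finset ℕ := R.filter (fun N => Nat.testBit N (n - 1) = true) with hT
  have hTR : T ⊆ R := Finset.filter_subset _ _
  have hmemT : ∀ {N : ℕ}, N ∈ T ↔ N < 2 ^ n ∧ Nat.testBit N (n - 1) = true := fun {N} => by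
    simp [hT, hR]
  have hcardT : (2 : ℝ) ^ n / 2 ≤ (T.card : ℝ) := by
    have hsub : Finset.Ico (2 ^ (n - 1)) (2 ^ n) ⊆ T := by
      intro N hN
      rw [Finset.mem_Ico] at hN
      refine hmemT.2 ⟨hN.2, Nat.testBit_of_two_pow_le_and_two_pow_add_one_gt hN.1 ?_⟩
      rw [Nat.sub_add_cancel (by omega : 1 ≤ n)]
      exact hN.2
    have hpow : 2 ^ n = 2 * 2 ^ (n - 1) := by
      rw [← pow_succ']
      congr 1
      omega
    have h1 : (Finset.Ico (2 ^ (n - 1)) (2 ^ n)).card = 2 ^ (n - 1) := by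
      rw [Nat.card_Ico]
      omega
    have h2 : (2 : ℝ) ^ n / 2 = ((2 ^ (n - 1) : ℕ) : ℝ) := by
      rw [Nat.cast_pow, Nat.cast_two]
      have : (2 : ℝ) ^ n = 2 * 2 ^ (n - 1) := by exact_mod_cast hpow
      rw [this]
      ring
    rw [h2, ← h1]
    exact_mod_cast Finset.card_le_card hsub
  -- pointwise facts on `T`
  have hlam : ∀ {N : ℕ}, N ∈ T →
      ArithmeticFunction.liouville N = 1 ∨ ArithmeticFunction.liouville N = -1 := by
    intro N hN
    have hN0 : N ≠ 0 := by
      rintro rfl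
      exact absurd (hmemT.1 hN).2 (by simp)
    rw [ArithmeticFunction.liouville_apply hN0]
    exact neg_one_pow_eq_or ℤ _
  have h01 : (0 : ZMod 2) ≠ 1 := by decide
  have hgood : ∀ N ∈ T, ¬ (fun i : Fin n => Nat.testBit N i) ∈ E →
      ((ArithmeticFunction.liouville N : ℤ) : ℝ) *
        (if MvPolynomial.eval (fun i : Fin n => if Nat.testBit N i then (1 : ZMod 2) else 0) P = 1
          then (-1 : ℝ) else 1) = 1 := by
    intro N hN hNE
    obtain ⟨hNlt, hNtop⟩ := hmemT.1 hN
    have hmem := ofFn_mem_toLanguage_iff {N : ℕ | ArithmeticFunction.liouville N = -1} hNlt hNtop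
    rw [hPeval (fun i : Fin n => Nat.testBit N i), hagree _ hNE, hdec.eval_eq]
    rcases hlam hN with h1 | h1
    · have hnot : List.ofFn (fun i : Fin n => Nat.testBit N i) ∉
          Computability.encodingNatBool.toLanguage
            {N : ℕ | ArithmeticFunction.liouville N = -1} := by
        rw [hmem]
        simp [h1]
      rw [(Set.notMem_iff_boolIndicator _ _).1 hnot, h1]
      simp [h01]
    · have hin : List.ofFn (fun i : Fin n => Nat.testBit N i) ∈
          Computability.encodingNatBool.toLanguage
            {N : ℕ | ArithmeticFunction.liouville N = -1} := by
        rw [hmem]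
        exact h1
      rw [(Set.mem_iff_boolIndicator _ _).1 hin, h1]
      simp
  have hbad : ∀ N ∈ T, (-1 : ℝ) ≤
      ((ArithmeticFunction.liouville N : ℤ) : ℝ) *
        (if MvPolynomial.eval (fun i : Fin n => if Nat.testBit N i then (1 : ZMod 2) else 0) P = 1
          then (-1 : ℝ) else 1) := by
    intro N hN
    rcases hlam hN with h1 | h1 <;> rw [h1] <;> split_ifs <;> norm_num
  -- the errors inside `T` are at most `|E|`
  have hfilt : (T.filter fun N => (fun i : Fin n => Nat.testBit N i) ∈ E).card ≤ E.card := by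
    refine Finset.card_le_card_of_injOn (fun N => fun i : Fin n => Nat.testBit N i) ?_ ?_
    · intro N hN
      have hN' := Finset.mem_filter.1 (Finset.mem_coe.1 hN)
      exact Finset.mem_coe.2 hN'.2
    · refine (testBit_injOn n).mono fun N hN => ?_
      have hN' := Finset.mem_filter.1 (Finset.mem_coe.1 hN)
      exact Finset.mem_coe.2 (hTR hN'.1)
  -- lower bound on the `T`-sum
  have hlow := card_sub_le_sum (T := T) (fun N => (fun i : Fin n => Nat.testBit N i) ∈ E) hgood hbad
  -- upper bound on the `T`-sum, from the two uniformity sums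
  have hSQ' : |∑ N ∈ R, ((ArithmeticFunction.liouville N : ℤ) : ℝ) *
        (if MvPolynomial.eval (fun i : Fin n => if Nat.testBit N i then (1 : ZMod 2) else 0) P = 1
          then (-1 : ℝ) else 1) *
        (if Nat.testBit N (n - 1) = true then (-1 : ℝ) else 1)| ≤ 1 / 8 * (2 : ℝ) ^ n := by
    refine le_of_eq_of_le (congrArg _ (Finset.sum_congr rfl fun N _ => ?_)) hSQ
    rw [hQdef, map_add, MvPolynomial.eval_X, mul_assoc, ← sign_add_bit]
  have hup := abs_sum_le_of_twist hTR (t := fun N => if Nat.testBit N (n - 1) = true then (-1 : ℝ) else 1)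
    (fun N hN => if_pos (hmemT.1 hN).2)
    (fun N hNR hNT => if_neg fun h => hNT (hmemT.2 ⟨by simpa [hR] using hNR, h⟩)) hSP hSQ'
  -- contradiction
  have hE8' : 8 * (E.card : ℝ) ≤ (2 : ℝ) ^ n := by exact_mod_cast hE8
  have hfilt' : ((T.filter fun N => (fun i : Fin n => Nat.testBit N i) ∈ E).card : ℝ) ≤ E.card := by
    exact_mod_cast hfilt
  have habs := (le_abs_self _).trans hup
  have h2n : (0 : ℝ) < 2 ^ n := pow_pos two_pos n
  linarith

end Summit.QuantumAdvantage.QuantumAdvantage.Theorems.MobiusLadder
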